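import Summits.RiemannHypothesis.RiemannHypothesis.Theorems.Splittings.LinearRayOnePointWindowA
import Summits.RiemannHypothesis.RiemannHypothesis.Theorems.Splittings.LinearRayResidueCells

/-!
# Linear ray, window B and assembly: `linearFactorH a` has a non-real zero for EVERY `0 < |a| ≤ 7/10`
# (certified computation + the tree's wide window)

ONE `native_decide` (window B): at `s = 1690/5 = 338.0`, `120` forward y-cells (`ρ_y = 1`, `R_y = 12`), scale `2¹⁸⁰`,
the one-point certificate holds on the 18 consecutive boxes `[0.60, 0.61], …, [0.63, 0.64], [0.64, 0.645], …, [0.705, 0.71]`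
(design: `h²/(Q(ah − h′))` from `0.18` at `a = 0.60` to `0.45` at `a = 0.71`; beyond `≈ 0.76` the certificate at this
pair fails and the next qualifying pairs (`γ ≈ 220.7, 415.0`) lie outside the reach of the 256-bit u-side evaluator).
ASSEMBLY: `|a| ≤ 0.31935` by the tree's residue theorem `LinearRayWideWindow.not_hasOnlyRealZeros_linearFactorH_of_abs_le_ext`
(theta cells), `0.3193 ≤ |a| ≤ 0.66` window A, `0.60 ≤ |a| ≤ 0.71` window B, mirror symmetry for `a < 0`:
**`not_hasOnlyRealZeros_linearFactorH_of_abs_le_seven_tenths : a ≠ 0 → |a| ≤ 7/10 → ¬ HasOnlyRealZeros (linearFactorH a)`**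
and `exists_nonreal_zero_linearFactorH_of_abs_le_seven_tenths`.  This contains the residue zero `a₀ = 0.31941…` and the
whole window `[π/8, 0.7]` BEYOND the wide window `|a| < π/8` of the barrier file (there both tails of `G_a` oscillate and
no residue argument exists; only Laguerre-type certificates can decide).  Axioms: std + the `native_decide` axioms of
`linRayWindowA_check` / `linRayWindowB_check` (filed `--computational`).
HONEST LABEL: machinery refuting an RH-STRENGTHENING conjunct (the linear-factor ray of
`Literature/Barriers/RiemannHypothesis/NewmanConjecture.lean`); RH-free; nothing here bears on the truth of RH.
Provenance: rh-splitx-eng-5 g3 (cell rh-split, D-0116 arm; C15 / S-dbn-1 filler → kernel), monolith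
`HOME/rh-splitx-eng-5/ray/LinearRayOnePointMono-v3.lean`.
-/

set_option linter.dupNamespace false

noncomputable section

namespace Summit.RiemannHypothesis.RiemannHypothesis.Theorems.Splittings.LinearRayOnePoint

open MeasureTheory Set
open Literature.NumberTheory.LFunctions
open Literature.Analysis.ValidatedNumerics Literature.Analysis.ValidatedNumerics.NumericsMP
open Literature.Barriers.RiemannHypothesis (linearFactorH hasOnlyRealZeros_linearFactorH_neg_iff)
open Summit.RiemannHypothesis.RiemannHypothesis.Theorems

/-- **Certified window B** (`native_decide`): at `s = 1690/5 = 338.0` (120 forward y-cells, `ρ_y = 1`,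
`R_y = 12`, scale `2¹⁸⁰`) the one-point check passes on the 18 consecutive boxes
`[0.60, 0.61, 0.62, 0.63, 0.64, 0.645, …, 0.71]`. [folklore] -/
theorem linRayWindowB_check :
    linRayCoverCheck { xn := 1690, xd := 5, rhoYn := 1, rhoYd := 1, RYn := 12, RYd := 1, CyB := 0, CyF := 120, dip := false }
      [6000, 6100, 6200, 6300, 6400, 6450, 6500, 6550, 6600, 6650, 6700, 6750, 6800, 6850, 6900, 6950, 7000,
        7050, 7100] 10000 180 = true := by
  native_decide

/-- Window B: for every `a ∈ [0.60, 0.71]`, `linearFactorH a` does not have only real zeros. [folklore] -/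
theorem not_hasOnlyRealZeros_linearFactorH_of_mem_windowB {a : ℝ} (h1 : (6000 : ℝ) / 10000 ≤ a)
    (h2 : a ≤ (7100 : ℝ) / 10000) : ¬ HasOnlyRealZeros (linearFactorH a) :=
  linRayCoverCheck_sound linRayWindowB_check (by exact_mod_cast h1) (by exact_mod_cast h2)

/-- `0.3193 ≤ a ≤ 0.71` from the two windows. [folklore] -/
theorem not_hasOnlyRealZeros_linearFactorH_of_mem_windows {a : ℝ} (h1 : (3193 : ℝ) / 10000 ≤ a)
    (h2 : a ≤ (7100 : ℝ) / 10000) : ¬ HasOnlyRealZeros (linearFactorH a) := by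
  by_cases h : a ≤ (6600 : ℝ) / 10000
  · exact not_hasOnlyRealZeros_linearFactorH_of_mem_windowA h1 h
  · exact not_hasOnlyRealZeros_linearFactorH_of_mem_windowB (by linarith) h2

/-- **THE LINEAR RAY IS REFUTED FOR EVERY `0 < |a| ≤ 7/10`.**  Below `0.31935` this is the tree's wide-window
residue theorem (`LinearRayWideWindow.not_hasOnlyRealZeros_linearFactorH_of_abs_le_ext`); on `[0.3193, 0.71]`
the one-point Laguerre certificates of windows A and B (pair `γ₆₃/γ₆₄`), which need no residue and therefore
also cover the residue zero `a₀ = 0.31941…` and the window `[π/8, 0.71]` BEYOND the wide window, where both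
tails of `G_a` oscillate and no residue argument exists.  RH-free; the ray is RH-strengthening
(`LinearRayTwoPoint.riemannHypothesis_of_exists_linearRay`), so nothing here bears on the truth of RH. [folklore] -/
theorem not_hasOnlyRealZeros_linearFactorH_of_abs_le_seven_tenths {a : ℝ} (ha : a ≠ 0)
    (h : |a| ≤ 7 / 10) : ¬ HasOnlyRealZeros (linearFactorH a) := by
  by_cases hlow : |a| ≤ 31935 / 100000
  · exact LinearRayWideWindow.not_hasOnlyRealZeros_linearFactorH_of_abs_le_ext ha hlow
  · push Not at hlow
    have h1 : (3193 : ℝ) / 10000 ≤ |a| := by linarith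
    have h2 : |a| ≤ (7100 : ℝ) / 10000 := by linarith
    rcases le_or_gt 0 a with hpos | hneg
    · rw [abs_of_nonneg hpos] at h1 h2
      exact not_hasOnlyRealZeros_linearFactorH_of_mem_windows h1 h2
    · rw [abs_of_neg hneg] at h1 h2
      exact fun hZ => not_hasOnlyRealZeros_linearFactorH_of_mem_windows h1 h2
        ((hasOnlyRealZeros_linearFactorH_neg_iff a).2 hZ)

/-- The same against the barrier file's constant: a non-real zero of `linearFactorH a` for every
`0 < |a| ≤ 7/10`. [folklore] -/
theorem exists_nonreal_zero_linearFactorH_of_abs_le_seven_tenths {a : ℝ} (ha : a ≠ 0)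
    (h : |a| ≤ 7 / 10) : ∃ z : ℂ, linearFactorH a z = 0 ∧ z.im ≠ 0 := by
  have h' := not_hasOnlyRealZeros_linearFactorH_of_abs_le_seven_tenths ha h
  unfold HasOnlyRealZeros at h'
  push Not at h'
  exact h'

end Summit.RiemannHypothesis.RiemannHypothesis.Theorems.Splittings.LinearRayOnePoint

end
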